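import Literature.NumberTheory.Sieve.LinearEquationsInPrimesLevelTwoInputs
import Mathlib.Analysis.SpecialFunctions.Pow.Real
import Mathlib.NumberTheory.ArithmeticFunction.Moebius
import HarnessLib

/-!
# Route `GreenTaoLevelTwo`, crux `MNTwo` (stmt-Parity-21276), line `birth`: bookkeeping for the
# vertical-reduction stub `stub_verticalReduction` (Green–Tao 2012a, Lemma 3.7 — the final step)

The registered stub `stub_verticalReduction : Signature.stub_mnVertical → MNTwo` of the `MNTwo`
birth skeleton reduces `MN(2)` for ALL `1`-bounded `M`-Lipschitz `F` on `Y = X^m × ℝ/ℤ` to the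
VERTICAL-CHARACTER case with polynomial dependence on the Lipschitz constant
(`MNAtVerticalPoly Y`).  Its proof has two layers:

* (harmonic analysis, NOT in this file) a *vertical approximation property*: every `1`-bounded
  `M`-Lipschitz `F` is, uniformly within `ε`, a combination `∑ⱼ wⱼ (F₁ⱼ + i F₂ⱼ)` of at most
  `Φ(M) ε^{-D}` vertical characters with weights `‖wⱼ‖ ≤ 1` and Lipschitz constants `Λ(M)`
  INDEPENDENT of `ε` (vertical Fourier expansion along the centre torus + Fejér-type smoothing,
  Green–Tao 2012a Lemma 3.7);
* (bookkeeping, THIS file) the vertical bound `C M^B N log^{-A'} N` summed over the characters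
  with `ε = log^{-A} N` and `A' = A (D + 1)` gives `MN(2)` for every fixed `M` and every `A`:
  `mnAt_of_verticalPoly_of_approx`.  The exponent `B` of the vertical bound may depend on `A'`
  (as the skeleton's `MNAtVerticalPoly` allows, `∃ C B` after `∀ A`); the reduction still closes
  because the NUMBER of characters is `ε`-polynomial with an exponent `D` that does not involve
  `B`, while their Lipschitz constants do not involve `ε`.

Everything is stated for an arbitrary `2`-step nilmanifold `Y` and an ARBITRARY predicate `P` in
place of the skeleton's `IsVertical Y` (so the file is definition-free and does not import the
`Cruxes/` skeleton); the closer instantiates `P := IsVertical Y`, `hMN := stub_mnVertical …`.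

References: B. Green, T. Tao, *The Möbius function is strongly orthogonal to nilsequences*,
Ann. of Math. 175 (2012), 541–566, Lemma 3.7 and the deduction of Thm. 1.1 from the vertical case
[GreenTao2012Mobius]; B. Green, T. Tao, *Linear equations in primes*, Ann. of Math. 171 (2010),
Conj. 8.5 [GreenTao2010].
-/

noncomputable section

open Literature.NumberTheory.Sieve

namespace Summit.Parity.GeneralizedHardyLittlewood.GreenTaoLevelTwoMNTwoVerticalReduction

variable {s : ℕ} (Y : Nilmanifold s)

/-! ### §1 Finite-sum bookkeeping -/

/-- The trivial bound: a `1`-bounded weight against a `1`-bounded function over `[N]` has sum at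
most `N` in absolute value. [folklore] -/
theorem abs_sum_mul_le_card (N : ℕ) (a : ℕ → ℝ) (ha : ∀ n, |a n| ≤ 1) (G : ℕ → ℝ)
    (hG : ∀ n, |G n| ≤ 1) : |∑ n ∈ Finset.Icc 1 N, a n * G n| ≤ N := by
  calc |∑ n ∈ Finset.Icc 1 N, a n * G n|
      ≤ ∑ n ∈ Finset.Icc 1 N, |a n * G n| := Finset.abs_sum_le_sum_abs _ _
    _ ≤ ∑ n ∈ Finset.Icc 1 N, (1 : ℝ) := Finset.sum_le_sum fun n _ => by
        rw [abs_mul]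
        calc |a n| * |G n| ≤ 1 * 1 := mul_le_mul (ha n) (hG n) (abs_nonneg _) zero_le_one
          _ = 1 := one_mul 1
    _ = N := by simp

/-- **Approximation bookkeeping.**  If `F` is uniformly within `ε` of `∑ⱼ wⱼ (F₁ⱼ + i F₂ⱼ)` with
`‖wⱼ‖ ≤ 1` (`j < n`), and each twisted sum `∑_t a(t) (F₁ⱼ + i F₂ⱼ)(y_t)` has norm at most `R`,
then `|∑_t a(t) F(y_t)| ≤ N ε + n R` for any `1`-bounded weight `a`. [folklore] -/
theorem abs_sum_le_of_approx (N : ℕ) (a : ℕ → ℝ) (ha : ∀ n, |a n| ≤ 1) (y : ℕ → Y.G ⧸ Y.Γ)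
    (F : Y.G ⧸ Y.Γ → ℝ) {n : ℕ} (w : Fin n → ℂ) (F₁ F₂ : Fin n → Y.G ⧸ Y.Γ → ℝ) {ε R : ℝ}
    (hw : ∀ j, ‖w j‖ ≤ 1)
    (happ : ∀ x, ‖(F x : ℂ) - ∑ j, w j * ((F₁ j x : ℂ) + (F₂ j x : ℂ) * Complex.I)‖ ≤ ε)
    (hR : ∀ j, ‖∑ t ∈ Finset.Icc 1 N, ((a t : ℝ) : ℂ) *
        ((F₁ j (y t) : ℂ) + (F₂ j (y t) : ℂ) * Complex.I)‖ ≤ R) :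
    |∑ t ∈ Finset.Icc 1 N, a t * F (y t)| ≤ N * ε + n * R := by
  -- abbreviations: the vertical pieces and the approximant
  set E : Fin n → ℕ → ℂ := fun j t => (F₁ j (y t) : ℂ) + (F₂ j (y t) : ℂ) * Complex.I with hE
  set V : ℕ → ℂ := fun t => ∑ j, w j * E j t with hV
  -- pointwise splitting `a F = a (F - V) + ∑ⱼ wⱼ (a Eⱼ)`
  have hsplit : ∀ t, ((a t : ℝ) : ℂ) * (F (y t) : ℂ) =
      ((a t : ℝ) : ℂ) * ((F (y t) : ℂ) - V t) + ∑ j, w j * (((a t : ℝ) : ℂ) * E j t) := by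
    intro t
    have h1 : ∑ j, w j * (((a t : ℝ) : ℂ) * E j t) = ((a t : ℝ) : ℂ) * V t := by
      rw [hV, Finset.mul_sum]
      exact Finset.sum_congr rfl fun j _ => by ring
    rw [h1]; ring
  -- summed splitting
  have hsum : ((∑ t ∈ Finset.Icc 1 N, a t * F (y t) : ℝ) : ℂ) =
      ∑ t ∈ Finset.Icc 1 N, ((a t : ℝ) : ℂ) * ((F (y t) : ℂ) - V t) +
        ∑ j, w j * ∑ t ∈ Finset.Icc 1 N, ((a t : ℝ) : ℂ) * E j t := by
    push_cast
    rw [Finset.sum_congr rfl fun t _ => hsplit t, Finset.sum_add_distrib, Finset.sum_comm]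
    congr 1
    exact Finset.sum_congr rfl fun j _ => by rw [Finset.mul_sum]
  -- first piece: `≤ N ε`
  have h1 : ‖∑ t ∈ Finset.Icc 1 N, ((a t : ℝ) : ℂ) * ((F (y t) : ℂ) - V t)‖ ≤ N * ε := by
    calc ‖∑ t ∈ Finset.Icc 1 N, ((a t : ℝ) : ℂ) * ((F (y t) : ℂ) - V t)‖
        ≤ ∑ t ∈ Finset.Icc 1 N, ‖((a t : ℝ) : ℂ) * ((F (y t) : ℂ) - V t)‖ := norm_sum_le _ _
      _ ≤ ∑ t ∈ Finset.Icc 1 N, ε := Finset.sum_le_sum fun t _ => by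
          rw [norm_mul, Complex.norm_real, Real.norm_eq_abs]
          calc |a t| * ‖(F (y t) : ℂ) - V t‖ ≤ ‖(F (y t) : ℂ) - V t‖ :=
                mul_le_of_le_one_left (norm_nonneg _) (ha t)
            _ ≤ ε := by rw [hV]; exact happ (y t)
      _ = N * ε := by simp
  -- second piece: `≤ n R`
  have h2 : ‖∑ j, w j * ∑ t ∈ Finset.Icc 1 N, ((a t : ℝ) : ℂ) * E j t‖ ≤ n * R := by
    calc ‖∑ j, w j * ∑ t ∈ Finset.Icc 1 N, ((a t : ℝ) : ℂ) * E j t‖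
        ≤ ∑ j, ‖w j * ∑ t ∈ Finset.Icc 1 N, ((a t : ℝ) : ℂ) * E j t‖ := norm_sum_le _ _
      _ ≤ ∑ _j : Fin n, R := Finset.sum_le_sum fun j _ => by
          rw [norm_mul]
          calc ‖w j‖ * ‖∑ t ∈ Finset.Icc 1 N, ((a t : ℝ) : ℂ) * E j t‖
              ≤ ‖∑ t ∈ Finset.Icc 1 N, ((a t : ℝ) : ℂ) * E j t‖ :=
                mul_le_of_le_one_left (norm_nonneg _) (hw j)
            _ ≤ R := hR j
      _ = n * R := by simp
  -- assemble
  rw [← Real.norm_eq_abs, ← Complex.norm_real, hsum]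
  exact (norm_add_le _ _).trans (add_le_add h1 h2)

/-! ### §2 The reduction -/

/-- **Vertical reduction, bookkeeping layer** (Green–Tao 2012a, deduction of Thm. 1.1 from the
vertical-character case via Lemma 3.7).  Let `Y` be a nilmanifold and `P` a property of pairs
`(F₁, F₂)` (read: "`F₁ + iF₂` is a vertical character").  Suppose
* (`hMN`) for every `A > 0` there are `C, B` with
  `‖∑_{n ≤ N} μ(n) (F₁ + iF₂)(gⁿx)‖ ≤ C M^B N / log^A N` for all `M ≥ 1`, `N ≥ 2`, `g`, `x` and all
  `1`-bounded `M`-Lipschitz `F₁, F₂` with `P F₁ F₂` (the skeleton's `MNAtVerticalPoly Y` with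
  `IsVertical Y` generalised to `P`);
* (`happrox`) every `1`-bounded `M`-Lipschitz `F` (`M ≥ 1`) is, for every `0 < ε ≤ 1`, uniformly
  within `ε` of some `∑_{j < n} wⱼ (F₁ⱼ + i F₂ⱼ)` with `n ≤ Φ(M) / ε^D`, `‖wⱼ‖ ≤ 1`, `F₁ⱼ, F₂ⱼ`
  `1`-bounded `Λ(M)`-Lipschitz and `P F₁ⱼ F₂ⱼ`.
Then `MN(2)` holds on `Y` for every Lipschitz constant: `GreenTao2010_MNAt s Y M` for all `M`
(with `A' = A (D + 1)`, `ε = log^{-A} N`, and the final constant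
`1 + max(Φ(M₁),0) · max(C,0) · max(Λ(M₁),1)^B`, `M₁ = max(M,1)`).
[cite: GreenTao2012Mobius, Lemma 3.7 and §3] -/
theorem mnAt_of_verticalPoly_of_approx (P : (Y.G ⧸ Y.Γ → ℝ) → (Y.G ⧸ Y.Γ → ℝ) → Prop)
    (hMN : ∀ A : ℝ, 0 < A → ∃ C B : ℝ, ∀ M : ℝ, 1 ≤ M → ∀ N : ℕ, 2 ≤ N →
      ∀ (g : Y.G) (x : Y.G ⧸ Y.Γ) (F₁ F₂ : Y.G ⧸ Y.Γ → ℝ),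
        Y.IsBoundedLipschitz M F₁ → Y.IsBoundedLipschitz M F₂ → P F₁ F₂ →
          ‖∑ n ∈ Finset.Icc 1 N, ((ArithmeticFunction.moebius n : ℝ) : ℂ) *
              ((F₁ (g ^ n • x) : ℂ) + (F₂ (g ^ n • x) : ℂ) * Complex.I)‖ ≤
            C * M ^ B * N / Real.log N ^ A)
    (D : ℕ) (Φ Λ : ℝ → ℝ)
    (happrox : ∀ (M ε : ℝ), 1 ≤ M → 0 < ε → ε ≤ 1 → ∀ F : Y.G ⧸ Y.Γ → ℝ,
      Y.IsBoundedLipschitz M F →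
        ∃ (n : ℕ) (w : Fin n → ℂ) (F₁ F₂ : Fin n → Y.G ⧸ Y.Γ → ℝ),
          (n : ℝ) ≤ Φ M / ε ^ D ∧ (∀ j, ‖w j‖ ≤ 1) ∧
          (∀ j, Y.IsBoundedLipschitz (Λ M) (F₁ j)) ∧ (∀ j, Y.IsBoundedLipschitz (Λ M) (F₂ j)) ∧
          (∀ j, P (F₁ j) (F₂ j)) ∧
          ∀ x, ‖(F x : ℂ) - ∑ j, w j * ((F₁ j x : ℂ) + (F₂ j x : ℂ) * Complex.I)‖ ≤ ε) :
    ∀ M : ℝ, GreenTao2010_MNAt s Y M := by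
  intro M₀ A hA
  -- normalise the Lipschitz constant
  set M : ℝ := max M₀ 1 with hMdef
  have hM1 : 1 ≤ M := le_max_right _ _
  -- the vertical bound at the larger saving `A' = A (D + 1)`
  have hA' : 0 < A * ((D : ℝ) + 1) := by positivity
  obtain ⟨C, B, hCB⟩ := hMN (A * ((D : ℝ) + 1)) hA'
  set C' : ℝ := max C 0 with hC'def
  have hC'0 : 0 ≤ C' := le_max_right _ _
  set M' : ℝ := max (Λ M) 1 with hM'def
  have hM'1 : 1 ≤ M' := le_max_right _ _
  have hM'0 : 0 < M' := by positivity
  set Φ' : ℝ := max (Φ M) 0 with hΦ'def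
  have hΦ'0 : 0 ≤ Φ' := le_max_right _ _
  have hMB : 0 ≤ M' ^ B := Real.rpow_nonneg hM'0.le B
  refine ⟨1 + Φ' * C' * M' ^ B, fun N hN g x F hF => ?_⟩
  have hFM : Y.IsBoundedLipschitz M F := hF.mono (le_max_left _ _)
  -- the logarithm
  have hN1 : (1 : ℝ) < N := by exact_mod_cast hN
  have hL0 : 0 < Real.log N := Real.log_pos hN1
  have hLA0 : 0 < Real.log N ^ A := Real.rpow_pos_of_pos hL0 A
  have hN0 : (0 : ℝ) ≤ N := Nat.cast_nonneg N
  have hfin1 : 1 ≤ 1 + Φ' * C' * M' ^ B := le_add_of_nonneg_right (by positivity)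
  -- the trivial bound
  -- `|μ(n)| ≤ 1` (the tree's `Iwaniec1978.abs_moebius_cast_le`, inlined to keep imports light)
  have hμ : ∀ n : ℕ, |((ArithmeticFunction.moebius n : ℤ) : ℝ)| ≤ 1 := fun n => by
    exact_mod_cast ArithmeticFunction.abs_moebius_le_one
  have htriv : |∑ n ∈ Finset.Icc 1 N, (ArithmeticFunction.moebius n : ℝ) * F (g ^ n • x)| ≤ N :=
    abs_sum_mul_le_card N _ hμ (fun n => F (g ^ n • x)) fun n => hF.1 _
  by_cases hL1 : Real.log N ≤ 1
  · -- small `N` (`log N ≤ 1`): the trivial bound suffices since `log^A N ≤ 1`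
    have hLA1 : Real.log N ^ A ≤ 1 := Real.rpow_le_one hL0.le hL1 hA.le
    calc |∑ n ∈ Finset.Icc 1 N, (ArithmeticFunction.moebius n : ℝ) * F (g ^ n • x)|
        ≤ N := htriv
      _ ≤ N / Real.log N ^ A := by
          rw [le_div_iff₀ hLA0]
          exact mul_le_of_le_one_right hN0 hLA1
      _ ≤ (1 + Φ' * C' * M' ^ B) * (N / Real.log N ^ A) :=
          le_mul_of_one_le_left (div_nonneg hN0 hLA0.le) hfin1
      _ = (1 + Φ' * C' * M' ^ B) * N / Real.log N ^ A := (mul_div_assoc _ _ _).symm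
  · -- large `N`: `ε = log^{-A} N ∈ (0, 1]`
    push Not at hL1
    have hLA1 : 1 ≤ Real.log N ^ A := Real.one_le_rpow hL1.le hA.le
    set ε : ℝ := (Real.log N ^ A)⁻¹ with hεdef
    have hε0 : 0 < ε := inv_pos.mpr hLA0
    have hε1 : ε ≤ 1 := inv_le_one_of_one_le₀ hLA1
    obtain ⟨n, w, F₁, F₂, hn, hw, hF₁, hF₂, hP, happ⟩ := happrox M ε hM1 hε0 hε1 F hFM
    -- the vertical bound for each piece, at Lipschitz constant `M'`
    set R : ℝ := C' * M' ^ B * N / Real.log N ^ (A * ((D : ℝ) + 1)) with hRdef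
    have hLA'0 : 0 < Real.log N ^ (A * ((D : ℝ) + 1)) := Real.rpow_pos_of_pos hL0 _
    have hR0 : 0 ≤ R := by positivity
    have hR : ∀ j, ‖∑ t ∈ Finset.Icc 1 N, (((ArithmeticFunction.moebius t : ℝ) : ℝ) : ℂ) *
        ((F₁ j (g ^ t • x) : ℂ) + (F₂ j (g ^ t • x) : ℂ) * Complex.I)‖ ≤ R := by
      intro j
      have h := hCB M' hM'1 N hN g x (F₁ j) (F₂ j) ((hF₁ j).mono (le_max_left _ _))
        ((hF₂ j).mono (le_max_left _ _)) (hP j)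
      refine h.trans ?_
      rw [hRdef]
      gcongr
      exact le_max_left C 0
    -- bookkeeping
    have hbook := abs_sum_le_of_approx Y N (fun t => (ArithmeticFunction.moebius t : ℝ))
      hμ (fun t => g ^ t • x) F w F₁ F₂ hw happ hR
    refine hbook.trans ?_
    -- `N ε = N / log^A N`
    have hNε : (N : ℝ) * ε = N / Real.log N ^ A := by rw [hεdef, div_eq_mul_inv]
    -- `n R ≤ Φ' (log^A N)^D R = Φ' C' M'^B N / log^A N`
    have hpow : Real.log N ^ (A * ((D : ℝ) + 1)) = (Real.log N ^ A) ^ D * Real.log N ^ A := by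
      have : (A * ((D : ℝ) + 1)) = A * ((D + 1 : ℕ) : ℝ) := by push_cast; ring
      rw [this, Real.rpow_mul_natCast hL0.le, pow_succ]
    have hn' : (n : ℝ) ≤ Φ' * (Real.log N ^ A) ^ D := by
      calc (n : ℝ) ≤ Φ M / ε ^ D := hn
        _ = Φ M * (Real.log N ^ A) ^ D := by
            rw [hεdef, inv_pow, div_inv_eq_mul]
        _ ≤ Φ' * (Real.log N ^ A) ^ D :=
            mul_le_mul_of_nonneg_right (le_max_left _ _) (pow_nonneg hLA0.le D)
    have hnR : (n : ℝ) * R ≤ Φ' * C' * M' ^ B * N / Real.log N ^ A := by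
      calc (n : ℝ) * R ≤ Φ' * (Real.log N ^ A) ^ D * R := mul_le_mul_of_nonneg_right hn' hR0
        _ = Φ' * C' * M' ^ B * N / Real.log N ^ A := by
            rw [hRdef, hpow]
            have hP0 : (Real.log N ^ A) ^ D ≠ 0 := pow_ne_zero D hLA0.ne'
            field_simp
    calc (N : ℝ) * ε + n * R ≤ N / Real.log N ^ A + Φ' * C' * M' ^ B * N / Real.log N ^ A := by
          rw [hNε]; exact add_le_add le_rfl hnR
      _ = (1 + Φ' * C' * M' ^ B) * N / Real.log N ^ A := by ring

end Summit.Parity.GeneralizedHardyLittlewood.GreenTaoLevelTwoMNTwoVerticalReduction
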